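import Summits.CriticalPhenomena.PercolationContinuityZ3.Theorems.PercNearOneGluingNoHeavyLowerTailKNConj1Holds
import Summits.CriticalPhenomena.PercolationContinuityZ3.Theorems.PercNearOneGluingNoHeavyLowerTailWorstPairExchangeIdentity
import HarnessLib

/-!
# Event gluing with the SHARP constant `1` on every finite weighted graph — the new-inequality factory's conjecture `EG_k`, settled

Support file (`--supports stmt-CriticalPhenomena-4575`), factory seat `prim-ineq-gen-7` (gen 6).  No definitions, no named facts, no
sorries; standard axioms.

Gens 1–5 of this seat reduced the crux `NoHeavyLowerTail` to the k-relay EVENT GLUING with constant `1`,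
`EG_k : μ({o ↔ A} ∩ {o ↮ c}) ≤ max_{a ∈ A} μ{a ↮ c}` (`noHeavyLowerTail_of_eventGluingConst 1`, `EventGluingClosure`), proved its
sharper RATIO form `μ({o ↔ A} ∩ {o ↮ c}) ≤ max_a μ{a ↮ c} · μ{o ↔ A ∪ {c}}` on apex-forests (kernel) and on cacti with cycles `≤ 4`
(paper), and recorded `0` failures in `1.65·10⁹` exact instances (ttrl request line 544).  The tree now holds the conditioned slack
hierarchy (`CSH.cshAll`, prim-hp-8 et al.) and, through it, Kozma–Nitzan's Conjecture 1 (`kozmaNitzan2024_conjecture1_holds`, ineq-gen-6).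
The proof of the latter passes through the master form (GEN) with `F = 1{b ∈ ·}` and discards the joint event at its last line; keeping it
gives, for EVERY finite weighted graph and every relay set:

* `gen_holds` — (GEN) unconditionally: `Σ_{a ∈ A} μ(P_a)·E F(C(a)) ≤ E[F(C(o)); o ↔ A]` for every monotone nonnegative cluster
  functional `F` and every `E F(C(·))`-compatible injective rank (first-in-rank patterns `P_a`);
* `jointGluing_holds` — the JOINT form of Conjecture 1 (Kozma–Nitzan's display (3) after FKG, with constant 1):
  `μ(o ↔ A)·t ≤ μ({o ↔ A} ∩ {o ↔ b})` whenever `t ≤ μ(a ↔ b)` for all `a ∈ A`;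
* `eventGluing_sharp` — `μ({o ↔ A} ∩ {o ↮ c}) ≤ s·μ(o ↔ A)` whenever `μ{a ↮ c} ≤ s` for all `a ∈ A` (no sign or size hypothesis);
  hence the ratio form `eventGluing_ratio` (`… ≤ s·μ({o ↔ A} ∪ {o ↔ c})`, `0 ≤ s`) of FINDING-RING-g4/g5 for ALL graphs, and the
  hypothesis of `noHeavyLowerTail_of_eventGluingConst 1` verbatim (`eventGluing_const_one`);
* `noHeavyLowerTail_via_eventGluing` — the crux once more, through the event-gluing glue of this seat (second glue path; same engine CSH).
[cite: KozmaNitzan2024, Conj. 1 and display (3) (p. 3), Conj. 4 (p. 32)]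
-/

noncomputable section

namespace Summit.CriticalPhenomena.PercolationContinuityZ3.Theorems

open MeasureTheory Set
open Literature.Probability.LatticeModels (prodBernoulli)
open Literature.Probability.Percolation
open scoped Classical

namespace EventGluingSharp

/-- **(GEN) on every finite weighted graph, unconditionally**: for every monotone nonnegative cluster functional `F`, relay set `A`,
observer `o` and injective rank `r` compatible with `a ↦ E F(C(a))`,
`Σ_{a ∈ A} μ({o ↔ a} ∩ ⋂_{r a' < r a} {o ↮ a'})·E F(C(a)) ≤ ∫_{o ↔ A} F(C(o))`.
Composition of the tree's `AGloc.gen_of_surplusTransfer`, `CSH.surplusTransfer_of_nondegenerate`,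
`CSH.surplusTransfer_nondegenerate_of_s5dMargin`, `CSH.s5dMargin_nonneg_of_csh` and `CSH.cshAll`.
[cite: KozmaNitzan2024, Conj. 4 (p. 32)] -/
theorem gen_holds :
    ∀ (n : ℕ) (w : Sym2 (Fin n) → unitInterval) (A : Finset (Fin n)) (o : Fin n) (F : Set (Fin n) → ℝ) (r : Fin n → ℕ),
      (∀ S S' : Set (Fin n), S ⊆ S' → F S ≤ F S') → (∀ S, 0 ≤ F S) → Set.InjOn r ↑A →
      (∀ a ∈ A, ∀ a' ∈ A, r a < r a' →
        ∫ ω, F (openCluster ω a) ∂(prodBernoulli w) ≤ ∫ ω, F (openCluster ω a') ∂(prodBernoulli w)) →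
      ∑ a ∈ A, (prodBernoulli w).real
            (openConn o a ∩ ⋂ a' ∈ A.filter (fun a' => r a' < r a), (openConn o a')ᶜ : Set (BondConfig (Fin n))) *
          ∫ ω, F (openCluster ω a) ∂(prodBernoulli w) ≤
        ∫ ω in (⋃ a ∈ A, openConn o a), F (openCluster ω o) ∂(prodBernoulli w) :=
  AGloc.gen_of_surplusTransfer fun n w T o v F r hvT hF _ hr hcompat =>
    CSH.surplusTransfer_of_nondegenerate T o v F
      (fun p hp r' hr' hc' =>
        CSH.surplusTransfer_nondegenerate_of_s5dMargin p hp T o v F r' hvT hr' hc' fun hoT hov =>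
          CSH.s5dMargin_nonneg_of_csh p hp o v (fun x Y D => CSH.cshAll n p hp o v x Y D hov) T r' [] F hF hr' hc'
            hoT hvT List.nodup_nil (fun _ hd => absurd hd List.not_mem_nil))
      w r hr hcompat

/-- **Joint form of Kozma–Nitzan's Conjecture 1 (constant 1), on every finite weighted graph**: if `t ≤ μ(a ↔ b)` for every `a ∈ A`,
then `μ(o ↔ A)·t ≤ μ({o ↔ A} ∩ {o ↔ b})`.  (GEN) at `F = 1{b ∈ ·}` with a `μ(· ↔ b)`-compatible rank: the first-in-rank patterns
partition `{o ↔ A}`, so `μ({o ↔ A} ∩ {o ↔ b}) ≥ Σ_a μ(P_a)·μ(a ↔ b) ≥ t·Σ_a μ(P_a) = t·μ(o ↔ A)` — the proof of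
`kozmaNitzan2024_conjecture1_of_gen` without its final weakening `μ({o ↔ A} ∩ {o ↔ b}) ≤ μ(o ↔ b)`.
[cite: KozmaNitzan2024, Conj. 1 and display (3) (p. 3)] -/
theorem jointGluing_holds (n : ℕ) (w : Sym2 (Fin n) → unitInterval) (A : Finset (Fin n)) (o b : Fin n) (t : ℝ)
    (ht : ∀ a ∈ A, t ≤ (prodBernoulli w).real (openConn a b)) :
    (prodBernoulli w).real (⋃ a ∈ A, openConn o a) * t ≤
      (prodBernoulli w).real ((⋃ a ∈ A, openConn o a) ∩ openConn o b : Set (BondConfig (Fin n))) := by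
  set μ := prodBernoulli w with hμ
  have hmeas : ∀ S : Set (BondConfig (Fin n)), MeasurableSet S := fun S => (Set.toFinite S).measurableSet
  -- the cluster functional `F = 1{b ∈ ·}`
  set F : Set (Fin n) → ℝ := fun M => if b ∈ M then 1 else 0 with hFdef
  have hFmono : ∀ S T : Set (Fin n), S ⊆ T → F S ≤ F T := by
    intro S T hST
    simp only [hFdef]
    by_cases hS : b ∈ S
    · rw [if_pos hS, if_pos (hST hS)]
    · rw [if_neg hS]
      split_ifs <;> norm_num
  have hF0 : ∀ S, 0 ≤ F S := by
    intro S
    simp only [hFdef]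
    split_ifs <;> norm_num
  have hFind : ∀ x : Fin n, (fun ω : BondConfig (Fin n) => F (openCluster ω x)) =
      (openConn x b : Set (BondConfig (Fin n))).indicator 1 := by
    intro x
    funext ω
    simp only [hFdef]
    by_cases hω : ω ∈ (openConn x b : Set (BondConfig (Fin n)))
    · rw [Set.indicator_of_mem hω, Pi.one_apply, if_pos (show b ∈ openCluster ω x from hω)]
    · rw [Set.indicator_of_notMem hω, if_neg (show b ∉ openCluster ω x from hω)]
  have hint : ∀ x : Fin n, ∫ ω, F (openCluster ω x) ∂μ = μ.real (openConn x b) := by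
    intro x
    rw [hFind x, integral_indicator_one (hmeas _)]
  have hsetint : ∫ ω in (⋃ a ∈ A, openConn o a), F (openCluster ω o) ∂μ =
      μ.real ((⋃ a ∈ A, openConn o a) ∩ openConn o b : Set (BondConfig (Fin n))) := by
    rw [hFind o, ← integral_indicator (hmeas _), Set.indicator_indicator,
      integral_indicator_one ((hmeas _).inter (hmeas _))]
  -- a reliability-compatible injective rank
  obtain ⟨r, hr, hrc⟩ := AGloc.exists_rank_compat A (fun a => μ.real (openConn a b))
  have hcompat : ∀ a ∈ A, ∀ a' ∈ A, r a < r a' →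
      ∫ ω, F (openCluster ω a) ∂μ ≤ ∫ ω, F (openCluster ω a') ∂μ := by
    intro a ha a' ha' hlt
    rw [hint a, hint a']
    exact hrc a ha a' ha' hlt
  have key := gen_holds n w A o F r hFmono hF0 hr hcompat
  rw [← hμ] at key
  simp only [hint] at key
  rw [hsetint] at key
  -- `Σ_a μ(P_a)·μ(a ↔ b) ≥ t·Σ_a μ(P_a) = t·μ(o ↔ A)`
  have hsum := AGloc.sum_measureReal_firstRank w A r o hr
  rw [← hμ] at hsum
  have hlow : ∑ a ∈ A, μ.real (openConn o a ∩ ⋂ a' ∈ A.filter (fun a' => r a' < r a), (openConn o a')ᶜ :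
        Set (BondConfig (Fin n))) * t ≤
      ∑ a ∈ A, μ.real (openConn o a ∩ ⋂ a' ∈ A.filter (fun a' => r a' < r a), (openConn o a')ᶜ :
        Set (BondConfig (Fin n))) * μ.real (openConn a b) :=
    Finset.sum_le_sum fun a ha => mul_le_mul_of_nonneg_left (ht a ha) measureReal_nonneg
  rw [← Finset.sum_mul, hsum] at hlow
  exact hlow.trans key

/-- **Event gluing with the sharp constant `1`, on every finite weighted graph**: if `μ{a ↮ c} ≤ s` for every `a ∈ A`, then
`μ({o ↔ A} ∩ {o ↮ c}) ≤ s·μ(o ↔ A)` (no sign, size or position hypothesis).  From `jointGluing_holds` at `t = 1 − s`: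
`μ({o ↔ A} ∩ {o ↮ c}) = μ(o ↔ A) − μ({o ↔ A} ∩ {o ↔ c}) ≤ μ(o ↔ A) − (1 − s)·μ(o ↔ A)`.
[cite: KozmaNitzan2024, Conj. 1 and display (3) (p. 3)] -/
theorem eventGluing_sharp (n : ℕ) (w : Sym2 (Fin n) → unitInterval) (A : Finset (Fin n)) (o c : Fin n) (s : ℝ)
    (hs : ∀ a ∈ A, (prodBernoulli w).real (openConn a c : Set (BondConfig (Fin n)))ᶜ ≤ s) :
    (prodBernoulli w).real ((⋃ a ∈ A, openConn o a) ∩ (openConn o c)ᶜ : Set (BondConfig (Fin n))) ≤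
      s * (prodBernoulli w).real (⋃ a ∈ A, openConn o a) := by
  set μ := prodBernoulli w with hμ
  have hmeas : ∀ S : Set (BondConfig (Fin n)), MeasurableSet S := fun S => (Set.toFinite S).measurableSet
  have ht : ∀ a ∈ A, 1 - s ≤ μ.real (openConn a c) := by
    intro a ha
    have h := hs a ha
    rw [probReal_compl_eq_one_sub (hmeas _)] at h
    linarith
  have hj := jointGluing_holds n w A o c (1 - s) ht
  rw [← hμ] at hj
  have hsplit := measureReal_inter_add_sdiff (μ := μ) (s := ⋃ a ∈ A, (openConn o a : Set (BondConfig (Fin n))))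
    (hmeas (openConn o c)) (measure_ne_top _ _)
  rw [Set.sdiff_eq] at hsplit
  nlinarith [hj, hsplit]

/-- The RATIO form of this seat's ring/cactus programme (FINDING-RING-g4 §0: `X ≤ max_a μ{a ↮ c}·Y`, `Y = μ{o ↔ A ∪ {c}}`), now for ALL
finite weighted graphs: `μ({o ↔ A} ∩ {o ↮ c}) ≤ s·μ({o ↔ A} ∪ {o ↔ c})` for `0 ≤ s` bounding every `μ{a ↮ c}`.
[cite: KozmaNitzan2024, Conj. 1 (p. 3)] -/
theorem eventGluing_ratio (n : ℕ) (w : Sym2 (Fin n) → unitInterval) (A : Finset (Fin n)) (o c : Fin n) (s : ℝ) (hs0 : 0 ≤ s)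
    (hs : ∀ a ∈ A, (prodBernoulli w).real (openConn a c : Set (BondConfig (Fin n)))ᶜ ≤ s) :
    (prodBernoulli w).real ((⋃ a ∈ A, openConn o a) ∩ (openConn o c)ᶜ : Set (BondConfig (Fin n))) ≤
      s * (prodBernoulli w).real ((⋃ a ∈ A, openConn o a) ∪ openConn o c : Set (BondConfig (Fin n))) :=
  (eventGluing_sharp n w A o c s hs).trans
    (mul_le_mul_of_nonneg_left (measureReal_mono Set.subset_union_left (measure_ne_top _ _)) hs0)

/-- The hypothesis of `noHeavyLowerTail_of_eventGluingConst` at the sharp constant `C = 1`, verbatim, discharged: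
`μ({o ↮ c} ∩ {o ↔ A}) ≤ 1·s` whenever `0 ≤ s` bounds every `μ{a ↮ c}`. [cite: KozmaNitzan2024, Conj. 1 (p. 3)] -/
theorem eventGluing_const_one :
    ∀ (n : ℕ) (w : Sym2 (Fin n) → unitInterval) (A : Finset (Fin n)) (o c : Fin n) (s : ℝ), 0 ≤ s →
      (∀ a ∈ A, (prodBernoulli w).real (openConn a c : Set (BondConfig (Fin n)))ᶜ ≤ s) →
      (prodBernoulli w).real ((openConn o c : Set (BondConfig (Fin n)))ᶜ ∩ ⋃ a ∈ A, openConn o a) ≤ 1 * s := by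
  intro n w A o c s hs0 hs
  rw [Set.inter_comm, one_mul]
  refine (eventGluing_sharp n w A o c s hs).trans ?_
  have h1 : (prodBernoulli w).real (⋃ a ∈ A, (openConn o a : Set (BondConfig (Fin n)))) ≤ 1 :=
    measureReal_le_one
  nlinarith [h1, hs0, measureReal_nonneg (μ := prodBernoulli w) (s := ⋃ a ∈ A, (openConn o a : Set (BondConfig (Fin n))))]

end EventGluingSharp

/-- **The crux `NoHeavyLowerTail` through the event-gluing glue** (`noHeavyLowerTail_of_eventGluingConst 1`, this seat's gen-1 reduction)
— a second glue path to the route decl, resting on the same engine (CSH). [cite: KozmaNitzan2024, Conjecture 3 (p. 15)] -/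
theorem noHeavyLowerTail_via_eventGluing :
    Summit.CriticalPhenomena.PercolationContinuityZ3.Theses.PercNearOneGluing.NoHeavyLowerTail :=
  noHeavyLowerTail_of_eventGluingConst 1 zero_le_one EventGluingSharp.eventGluing_const_one

end Summit.CriticalPhenomena.PercolationContinuityZ3.Theorems

end
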